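import Summits.QuantumFields.YangMills.Theorems.AlphaInputsT3ACv3TransfiniteFillExp
import Summits.QuantumFields.YangMills.Theorems.AlphaInputsT3ACv3GaugeInterp
import HarnessLib

/-!
# `AlphaInputsT3ACv3ModelBoxLog` — the (S3) → (S4) SEAM of the 19936 (FL) START v3∕v3.1 on ★w1-19936 g2 LEAD's model box: **THE LOGARITHM FIELD OF A NEAR-IDENTITY BOX FIELD**
# `logB W u μ := mlog (W u μ) ∈ 𝔰𝔲(n)` (on the log window), `expSU (logB W) = W`, `‖logB W‖ ≤ 2·dist1 W`, ★ `‖curlB (logB W)‖ ≤ dist1 (plaqB W) + 64ρ²`; the BOUNDARY PACKAGING in the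
# `hA`∕`hB` predicates of `…TransfiniteFillBox`; and the COMPOSITE ★★ `startB R W := expSU ∘ fillSU R (logB W)`: EQUAL TO `W` on boundary bonds and with box plaquettes
# `≤ b′ + 8ρ∕R + 640ρ²` from `dist1 (W b) ≤ ρ` on boundary bonds and `dist1 (plaqB W) ≤ b′` on boundary plaquettes — cell `ym3-torus`, width seat `ym-ust-19936-w3` (g0)

WHY (memo `NONABELIAN-FL-START-w1-g2.md` §3 (B) + START v3.1 (iii), LEAD bus 02:53:00Z: «(B)∕(S3)∕(S4) are needed ONLY at INTERIOR vertices: the full cube `Q_v`, ★w5 g2's closed-surface σ +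
★w3's `expSU ∘ fillSU`»).  ★w5 g2's (S3) delivers a boundary gauge with `W := σ·U·σ⁻¹` near `1` on the boundary shell (`dist1 (W b) ≤ ρ = C·R·b`); (S4) wants `𝔰𝔲`-valued boundary
LOGARITHMS `A` with `‖A‖ ≤ a` on `BdryBond` and `‖curlB A‖ ≤ b` on `BdryPlaq`.  THIS FILE is the seam, by name:
* §1 (★w2 g2's `GaugeInterp.mlog_mem_lieSU` imported) `LogWindow`, `logB` (defs), `coe_logB`, ★ `expSU_logB`,
  `norm_logB_le`, `norm_logB_le_of_dist1`, `plaqB_expSU_logB` (the exponential field of the logs IS `W` on a plaquette whose four bonds are in the window), ★ `norm_curlB_logB_le`.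
* §2 packaging: `logBM W v κ := (logB W v κ : Matrix)` read through `hA_of_dist1` (`‖·‖ ≤ 2ρ` on `BdryBond`) and `hB_of_dist1` (`‖curlB ·‖ ≤ b′ + 64ρ²` on `BdryPlaq`).
* §3 ★★ `startB` + `startB_eq_of_bdryBond` (glue) + `dist1_plaqB_startB_le` (`≤ b′ + 8ρ∕R + 640ρ²` on `PlaqInBox`, `24ρ ≤ 1`, `|n|ρ < π`, `R ≠ 0`) + gauged twin.
HONEST FRAMING.  Bookkeeping over landed letters; nothing of [Balaban1985UV3]∕[Balaban1985Variational]∕[Balaban1985Averaging] is asserted; (S3) (the gauge σ), (S5), (S6), (FL)∕`hLift`,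
the stub 2′χ, the crux `HistoryTailL` and any gap are NOT claimed; count-neutral helper (`--supports stmt-QuantumFields-19936`); registry untouched.  YM₃ on the three-torus is a
RUNG of the programme, not the Clay problem; nothing here is about d = 4, infinite volume or a mass gap.

References: T. Bałaban, Commun. Math. Phys. 98 (1985) 17–51 [Balaban1985Averaging] ((20)–(23) p.21: the logarithm on the unitary group near 1); Commun. Math. Phys. 102 (1985)
277–309 [Balaban1985Variational] ((8), (11)–(13) pp.279–280).
-/

set_option autoImplicit false

noncomputable section

open scoped Matrix.Norms.L2Operator
open NormedSpace

namespace Summit.QuantumFields.YangMills.Theorems.ModelBox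

open Literature.MathematicalPhysics.QuantumFieldTheory.Balaban1983to89
open Literature.MathematicalPhysics.QuantumFieldTheory.Balaban1983to89.MatrixLog (mlog exp_mlog norm_mlog_le_two_mul)
open Literature.MathematicalPhysics.QuantumFieldTheory.Balaban1983to89.T4AdjointCovarianceUnitary (lieSU expSU coe_expSU)
open Summit.QuantumFields.YangMills.Theorems.PerturbedPlaquette (dist1_SU_eq)
open Summit.QuantumFields.YangMills.Theorems.GaugeInterp (mlog_mem_lieSU)
open Summit.QuantumFields.YangMills.Theorems.TransfiniteFill (fillSU expSU_fillSU_eq_of_bdryBond dist1_plaqB_expSU_fillSU_le)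

variable {d : ℕ} {n : Type*} [Fintype n] [DecidableEq n]

/-! ## §1 The logarithm field -/

/-- The log window of a matrix: `‖W − 1‖ ≤ 1/4 ∧ |n|·‖W − 1‖ < π`. [cite: Balaban1985Averaging, (20) p.21] -/
def LogWindow (W : Matrix.specialUnitaryGroup n ℂ) : Prop := ‖(W : Matrix n n ℂ) - 1‖ ≤ 1 / 4 ∧ (Fintype.card n : ℝ) * ‖(W : Matrix n n ℂ) - 1‖ < Real.pi

/-- A bond with `dist1 ≤ ρ ≤ 1/4`, `|n|ρ < π` is in the log window. [cite: Balaban1985Averaging, (20) p.21] -/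
theorem logWindow_of_dist1 [Nonempty n] {W : Matrix.specialUnitaryGroup n ℂ} {ρ : ℝ} (h : GaugeGroup.dist1 W ≤ ρ) (hρ4 : ρ ≤ 1 / 4) (hρπ : (Fintype.card n : ℝ) * ρ < Real.pi) :
    LogWindow W := by
  rw [dist1_SU_eq] at h
  exact ⟨h.trans hρ4, lt_of_le_of_lt (mul_le_mul_of_nonneg_left h (Nat.cast_nonneg _)) hρπ⟩

open scoped Classical in
/-- **THE LOGARITHM FIELD** of a box field `W : bonds → SU(n)`: `mlog (W u μ)` packaged in `𝔰𝔲(n)` on the log window, `0` off it (a harmless `dite`; every use is on the window).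
[cite: Balaban1985Averaging, (20)–(23) p.21] -/
def logB (W : (Fin d → ℤ) → Fin d → Matrix.specialUnitaryGroup n ℂ) (u : Fin d → ℤ) (μ : Fin d) : lieSU n :=
  if h : LogWindow (W u μ) then ⟨mlog (W u μ : Matrix n n ℂ), mlog_mem_lieSU (W u μ) h.1 h.2⟩ else 0

/-- On the window, `logB W u μ = mlog (W u μ)` as a matrix. [cite: Balaban1985Averaging, (20) p.21] -/
theorem coe_logB {W : (Fin d → ℤ) → Fin d → Matrix.specialUnitaryGroup n ℂ} {u : Fin d → ℤ} {μ : Fin d} (h : LogWindow (W u μ)) :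
    ((logB W u μ : lieSU n) : Matrix n n ℂ) = mlog (W u μ : Matrix n n ℂ) := by
  unfold logB; rw [dif_pos h]

/-- **★ `exp ∘ log = id`**: `expSU (logB W u μ) = W u μ` on the window. [cite: Balaban1985Averaging, (21)–(22) p.21] -/
theorem expSU_logB {W : (Fin d → ℤ) → Fin d → Matrix.specialUnitaryGroup n ℂ} {u : Fin d → ℤ} {μ : Fin d} (h : LogWindow (W u μ)) : expSU (logB W u μ) = W u μ := by
  apply Subtype.ext
  rw [coe_expSU, coe_logB h, exp_mlog (h.1.trans_lt (by norm_num))]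

/-- `‖logB W u μ‖ ≤ 2·‖W u μ − 1‖` on the window. [cite: Balaban1985Averaging, (26) p.22] -/
theorem norm_logB_le {W : (Fin d → ℤ) → Fin d → Matrix.specialUnitaryGroup n ℂ} {u : Fin d → ℤ} {μ : Fin d} (h : LogWindow (W u μ)) :
    ‖((logB W u μ : lieSU n) : Matrix n n ℂ)‖ ≤ 2 * ‖((W u μ : Matrix.specialUnitaryGroup n ℂ) : Matrix n n ℂ) - 1‖ := by
  rw [coe_logB h]; exact norm_mlog_le_two_mul (h.1.trans (by norm_num))

/-- `‖logB W u μ‖ ≤ 2ρ` from `dist1 (W u μ) ≤ ρ ≤ 1/4`, `|n|ρ < π`. [cite: Balaban1985Averaging, (26) p.22] -/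
theorem norm_logB_le_of_dist1 [Nonempty n] {W : (Fin d → ℤ) → Fin d → Matrix.specialUnitaryGroup n ℂ} {u : Fin d → ℤ} {μ : Fin d} {ρ : ℝ} (h : GaugeGroup.dist1 (W u μ) ≤ ρ)
    (hρ4 : ρ ≤ 1 / 4) (hρπ : (Fintype.card n : ℝ) * ρ < Real.pi) : ‖((logB W u μ : lieSU n) : Matrix n n ℂ)‖ ≤ 2 * ρ := by
  refine (norm_logB_le (logWindow_of_dist1 h hρ4 hρπ)).trans ?_
  rw [← dist1_SU_eq]; linarith

/-- On a plaquette whose four bonds are in the window, the exponential field of the logs IS `W`. [cite: Balaban1985Averaging, (21)–(22) p.21] -/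
theorem plaqB_expSU_logB {W : (Fin d → ℤ) → Fin d → Matrix.specialUnitaryGroup n ℂ} {u : Fin d → ℤ} {μ ν : Fin d} (h1 : LogWindow (W u μ)) (h2 : LogWindow (W (u + e μ) ν))
    (h3 : LogWindow (W (u + e ν) μ)) (h4 : LogWindow (W u ν)) : plaqB (fun v κ => expSU (logB W v κ)) u μ ν = plaqB W u μ ν := by
  simp only [plaqB_def, expSU_logB h1, expSU_logB h2, expSU_logB h3, expSU_logB h4]

/-- **★ THE CURL OF THE LOGS FROM THE PLAQUETTE**: `‖curlB (logB W) u μ ν‖ ≤ dist1 (plaqB W u μ ν) + 64ρ²` from `dist1 (W bᵢ) ≤ ρ` on the four bonds (`8ρ ≤ 1`, `|n|ρ < π`).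
[cite: Balaban1985Averaging, (9) p.19, (20)–(26) pp.21–22] -/
theorem norm_curlB_logB_le [Nonempty n] (W : (Fin d → ℤ) → Fin d → Matrix.specialUnitaryGroup n ℂ) (u : Fin d → ℤ) (μ ν : Fin d) {ρ : ℝ} (h8 : 8 * ρ ≤ 1)
    (hρπ : (Fintype.card n : ℝ) * ρ < Real.pi) (h1 : GaugeGroup.dist1 (W u μ) ≤ ρ) (h2 : GaugeGroup.dist1 (W (u + e μ) ν) ≤ ρ) (h3 : GaugeGroup.dist1 (W (u + e ν) μ) ≤ ρ)
    (h4 : GaugeGroup.dist1 (W u ν) ≤ ρ) :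
    ‖((curlB (logB W) u μ ν : lieSU n) : Matrix n n ℂ)‖ ≤ GaugeGroup.dist1 (plaqB W u μ ν) + 64 * ρ ^ 2 := by
  have hρ4 : ρ ≤ 1 / 4 := by linarith
  have key := norm_curlB_le_dist1_plaqB_expSU_add (logB W) u μ ν (δ := 2 * ρ) (by linarith) (norm_logB_le_of_dist1 h1 hρ4 hρπ) (norm_logB_le_of_dist1 h2 hρ4 hρπ)
    (norm_logB_le_of_dist1 h3 hρ4 hρπ) (norm_logB_le_of_dist1 h4 hρ4 hρπ)
  rw [plaqB_expSU_logB (logWindow_of_dist1 h1 hρ4 hρπ) (logWindow_of_dist1 h2 hρ4 hρπ) (logWindow_of_dist1 h3 hρ4 hρπ) (logWindow_of_dist1 h4 hρ4 hρπ)] at key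
  linarith

/-! ## §2 Packaging in the `hA` ∕ `hB` predicates of the fill -/

/-- The logarithm field read in matrices. [folklore] -/
theorem logB_mem (W : (Fin d → ℤ) → Fin d → Matrix.specialUnitaryGroup n ℂ) (v : Fin d → ℤ) (κ : Fin d) : ((logB W v κ : lieSU n) : Matrix n n ℂ) ∈ lieSU n := (logB W v κ).2

/-- **`hA` FROM `dist1` ON BOUNDARY BONDS**: `‖logB W v κ‖ ≤ 2ρ` on `BdryBond R`. [cite: Balaban1985Averaging, (26) p.22] -/
theorem hA_of_dist1 [Nonempty n] {R : ℕ} {W : (Fin d → ℤ) → Fin d → Matrix.specialUnitaryGroup n ℂ} {ρ : ℝ} (hW : ∀ v κ, BdryBond R v κ → GaugeGroup.dist1 (W v κ) ≤ ρ)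
    (hρ4 : ρ ≤ 1 / 4) (hρπ : (Fintype.card n : ℝ) * ρ < Real.pi) :
    ∀ v κ, BdryBond R v κ → ‖((logB W v κ : lieSU n) : Matrix n n ℂ)‖ ≤ 2 * ρ :=
  fun v κ h => norm_logB_le_of_dist1 (hW v κ h) hρ4 hρπ

/-- **`hB` FROM `dist1` ON BOUNDARY BONDS AND PLAQUETTES**: `‖curlB (logB W) v μ ν‖ ≤ b′ + 64ρ²` on `BdryPlaq R`. [cite: Balaban1985Averaging, (9) p.19, (26) p.22] -/
theorem hB_of_dist1 [Nonempty n] {R : ℕ} {W : (Fin d → ℤ) → Fin d → Matrix.specialUnitaryGroup n ℂ} {ρ b' : ℝ} (hW : ∀ v κ, BdryBond R v κ → GaugeGroup.dist1 (W v κ) ≤ ρ)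
    (hP : ∀ v μ ν, BdryPlaq R v μ ν → GaugeGroup.dist1 (plaqB W v μ ν) ≤ b') (h8 : 8 * ρ ≤ 1) (hρπ : (Fintype.card n : ℝ) * ρ < Real.pi) :
    ∀ v μ ν, BdryPlaq R v μ ν → ‖curlB (fun w κ => ((logB W w κ : lieSU n) : Matrix n n ℂ)) v μ ν‖ ≤ b' + 64 * ρ ^ 2 := fun v μ ν h => by
  obtain ⟨b1, b2, b3, b4⟩ := h.bdryBond
  simp only [curlB_def]
  rw [← coe_curlB_lieSU]
  exact (norm_curlB_logB_le W v μ ν h8 hρπ (hW _ _ b1) (hW _ _ b2) (hW _ _ b3) (hW _ _ b4)).trans (by linarith [hP v μ ν h])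

/-! ## §3 The START field on an interior-vertex box -/

/-- **★★ THE START FIELD ON THE BOX** of half-side `R`: the exponential of the `𝔰𝔲`-valued Coons fill of the boundary logarithms of `W`. [cite: Balaban1985Variational, (8)+(11)–(13) pp.279–280] -/
def startB (R : ℕ) (W : (Fin 3 → ℤ) → Fin 3 → Matrix.specialUnitaryGroup n ℂ) (u : Fin 3 → ℤ) (μ : Fin 3) : Matrix.specialUnitaryGroup n ℂ :=
  expSU (fillSU R (fun v κ => ((logB W v κ : lieSU n) : Matrix n n ℂ)) (logB_mem W) u μ)

/-- **GLUE**: on a boundary bond in the log window the START field IS `W`. [cite: Balaban1985Variational, (11)–(13) pp.279–280] -/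
theorem startB_eq_of_bdryBond {R : ℕ} (hR : R ≠ 0) (W : (Fin 3 → ℤ) → Fin 3 → Matrix.specialUnitaryGroup n ℂ) {u : Fin 3 → ℤ} {μ : Fin 3} (hb : BdryBond R u μ)
    (hw : LogWindow (W u μ)) : startB R W u μ = W u μ := by
  unfold startB
  rw [expSU_fillSU_eq_of_bdryBond hR _ (logB_mem W) hb]
  exact expSU_logB hw

/-- **GLUE, `dist1` form**: on boundary bonds with `dist1 (W b) ≤ ρ ≤ 1/4`, `|n|ρ < π`, `startB R W = W`. [cite: Balaban1985Variational, (11)–(13) pp.279–280] -/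
theorem startB_eq_of_bdryBond_of_dist1 [Nonempty n] {R : ℕ} (hR : R ≠ 0) (W : (Fin 3 → ℤ) → Fin 3 → Matrix.specialUnitaryGroup n ℂ) {ρ : ℝ}
    (hW : ∀ v κ, BdryBond R v κ → GaugeGroup.dist1 (W v κ) ≤ ρ) (hρ4 : ρ ≤ 1 / 4) (hρπ : (Fintype.card n : ℝ) * ρ < Real.pi) {u : Fin 3 → ℤ} {μ : Fin 3} (hb : BdryBond R u μ) :
    startB R W u μ = W u μ :=
  startB_eq_of_bdryBond hR W hb (logWindow_of_dist1 (hW u μ hb) hρ4 hρπ)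

/-- **★★ THE PLAQUETTES OF THE START FIELD ON THE BOX**: from `dist1 (W b) ≤ ρ` on boundary bonds (`24ρ ≤ 1`, `|n|ρ < π`) and `dist1 (plaqB W) ≤ b′` on boundary plaquettes, every
box plaquette (`μ ≠ ν`) has `dist1 (plaqB (startB R W) u μ ν) ≤ b′ + 8ρ∕R + 640ρ²` — with ★w5 g2's `ρ = C·R·b` this is `b′ + 8C·b + 640C²R²b²`, k-uniform.
[cite: Balaban1985Variational, (8)+(11)–(13) pp.279–280] -/
theorem dist1_plaqB_startB_le [Nonempty n] {R : ℕ} (hR : R ≠ 0) (W : (Fin 3 → ℤ) → Fin 3 → Matrix.specialUnitaryGroup n ℂ) {ρ b' : ℝ} (hρ : 0 ≤ ρ) (h24 : 24 * ρ ≤ 1)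
    (hρπ : (Fintype.card n : ℝ) * ρ < Real.pi) (hW : ∀ v κ, BdryBond R v κ → GaugeGroup.dist1 (W v κ) ≤ ρ) (hP : ∀ v μ ν, BdryPlaq R v μ ν → GaugeGroup.dist1 (plaqB W v μ ν) ≤ b')
    {u : Fin 3 → ℤ} {μ ν : Fin 3} (hμν : μ ≠ ν) (hu : PlaqInBox R u μ ν) :
    GaugeGroup.dist1 (plaqB (startB R W) u μ ν) ≤ b' + 8 * ρ / R + 640 * ρ ^ 2 := by
  have h := dist1_plaqB_expSU_fillSU_le hR (fun v κ => ((logB W v κ : lieSU n) : Matrix n n ℂ)) (logB_mem W) (a := 2 * ρ) (b := b' + 64 * ρ ^ 2) (by linarith) (by linarith)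
    (hA_of_dist1 hW (by linarith) hρπ) (hB_of_dist1 hW hP (by linarith) hρπ) hμν hu
  have hRr : (0 : ℝ) < R := by exact_mod_cast Nat.pos_of_ne_zero hR
  calc GaugeGroup.dist1 (plaqB (startB R W) u μ ν) ≤ b' + 64 * ρ ^ 2 + 4 * (2 * ρ) / R + 144 * (2 * ρ) ^ 2 := h
    _ = b' + 8 * ρ / R + 640 * ρ ^ 2 := by field_simp; ring

/-- The same for the gauged START field `(startB R W)^g` (e.g. undoing ★w5 g2's boundary gauge σ). [cite: Balaban1985Averaging, (12) p.19] -/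
theorem dist1_plaqB_gaugeB_startB_le [Nonempty n] {R : ℕ} (hR : R ≠ 0) (W : (Fin 3 → ℤ) → Fin 3 → Matrix.specialUnitaryGroup n ℂ) {ρ b' : ℝ} (hρ : 0 ≤ ρ) (h24 : 24 * ρ ≤ 1)
    (hρπ : (Fintype.card n : ℝ) * ρ < Real.pi) (hW : ∀ v κ, BdryBond R v κ → GaugeGroup.dist1 (W v κ) ≤ ρ) (hP : ∀ v μ ν, BdryPlaq R v μ ν → GaugeGroup.dist1 (plaqB W v μ ν) ≤ b')
    (g : (Fin 3 → ℤ) → Matrix.specialUnitaryGroup n ℂ) {u : Fin 3 → ℤ} {μ ν : Fin 3} (hμν : μ ≠ ν) (hu : PlaqInBox R u μ ν) :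
    GaugeGroup.dist1 (plaqB (gaugeB g (startB R W)) u μ ν) ≤ b' + 8 * ρ / R + 640 * ρ ^ 2 := by
  rw [dist1_plaqB_gaugeB]
  exact dist1_plaqB_startB_le hR W hρ h24 hρπ hW hP hμν hu

/-! ## §4 Appendix (g0, 03:1xZ): the START in the ORIGINAL gauge — one statement in `U` and ★w5 g2's boundary gauge `σ` -/

/-- Undoing a model gauge: `(U^σ)^{σ⁻¹} = U`. [cite: Balaban1985Averaging, (8) p.19] -/
theorem gaugeB_inv_gaugeB {G : Type*} [Group G] (g : (Fin d → ℤ) → G) (U : (Fin d → ℤ) → Fin d → G) :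
    gaugeB (fun u => (g u)⁻¹) (gaugeB g U) = U := by
  funext u μ
  simp only [gaugeB_def]
  group

/-- **★★ THE START ON AN INTERIOR-VERTEX BOX, ORIGINAL GAUGE**: `startGauged R σ U := (startB R (U^σ))^{σ⁻¹}` — the exponential Coons fill of the boundary logarithms of the
σ-gauged field, gauged back. [cite: Balaban1985Variational, (8)+(11)–(13) pp.279–280] -/
def startGauged (R : ℕ) (σ : (Fin 3 → ℤ) → Matrix.specialUnitaryGroup n ℂ) (U : (Fin 3 → ℤ) → Fin 3 → Matrix.specialUnitaryGroup n ℂ) (u : Fin 3 → ℤ) (μ : Fin 3) :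
    Matrix.specialUnitaryGroup n ℂ :=
  gaugeB (fun v => (σ v)⁻¹) (startB R (gaugeB σ U)) u μ

/-- **GLUE IN THE ORIGINAL GAUGE**: on boundary bonds (with `dist1 ((U^σ) b) ≤ ρ ≤ 1/4`, `|n|ρ < π` there) the START IS `U`. [cite: Balaban1985Variational, (11)–(13) pp.279–280] -/
theorem startGauged_eq_of_bdryBond [Nonempty n] {R : ℕ} (hR : R ≠ 0) (σ : (Fin 3 → ℤ) → Matrix.specialUnitaryGroup n ℂ) (U : (Fin 3 → ℤ) → Fin 3 → Matrix.specialUnitaryGroup n ℂ)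
    {ρ : ℝ} (hW : ∀ v κ, BdryBond R v κ → GaugeGroup.dist1 (gaugeB σ U v κ) ≤ ρ) (hρ4 : ρ ≤ 1 / 4) (hρπ : (Fintype.card n : ℝ) * ρ < Real.pi) {u : Fin 3 → ℤ} {μ : Fin 3}
    (hb : BdryBond R u μ) : startGauged R σ U u μ = U u μ := by
  have h := startB_eq_of_bdryBond_of_dist1 hR (gaugeB σ U) hW hρ4 hρπ hb
  have hU : U u μ = gaugeB (fun v => (σ v)⁻¹) (gaugeB σ U) u μ := by rw [gaugeB_inv_gaugeB]
  rw [hU, startGauged, gaugeB_def, gaugeB_def, h]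

/-- **★★ THE PLAQUETTES OF THE START, ORIGINAL GAUGE**: from ★w5 g2's (S3) conclusion `dist1 ((U^σ) b) ≤ ρ` on boundary bonds (`24ρ ≤ 1`, `|n|ρ < π`) and the REGULARITY of `U` itself
`dist1 (plaqB U) ≤ b′` on boundary plaquettes (gauge invariant), every box plaquette (`μ ≠ ν`) of the START has `dist1 ≤ b′ + 8ρ∕R + 640ρ²`.
[cite: Balaban1985Variational, (8)+(11)–(13) pp.279–280; Balaban1985Averaging, (12) p.19] -/
theorem dist1_plaqB_startGauged_le [Nonempty n] {R : ℕ} (hR : R ≠ 0) (σ : (Fin 3 → ℤ) → Matrix.specialUnitaryGroup n ℂ) (U : (Fin 3 → ℤ) → Fin 3 → Matrix.specialUnitaryGroup n ℂ)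
    {ρ b' : ℝ} (hρ : 0 ≤ ρ) (h24 : 24 * ρ ≤ 1) (hρπ : (Fintype.card n : ℝ) * ρ < Real.pi) (hW : ∀ v κ, BdryBond R v κ → GaugeGroup.dist1 (gaugeB σ U v κ) ≤ ρ)
    (hP : ∀ v μ ν, BdryPlaq R v μ ν → GaugeGroup.dist1 (plaqB U v μ ν) ≤ b') {u : Fin 3 → ℤ} {μ ν : Fin 3} (hμν : μ ≠ ν) (hu : PlaqInBox R u μ ν) :
    GaugeGroup.dist1 (plaqB (startGauged R σ U) u μ ν) ≤ b' + 8 * ρ / R + 640 * ρ ^ 2 := by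
  have hP' : ∀ v μ ν, BdryPlaq R v μ ν → GaugeGroup.dist1 (plaqB (gaugeB σ U) v μ ν) ≤ b' := fun v μ ν h => by rw [dist1_plaqB_gaugeB]; exact hP v μ ν h
  have h := dist1_plaqB_gaugeB_startB_le hR (gaugeB σ U) hρ h24 hρπ hW hP' (fun v => (σ v)⁻¹) hμν hu
  exact h

end Summit.QuantumFields.YangMills.Theorems.ModelBox

end
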